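import Summits.BirchSwinnertonDyer.Rank1Residual.X11b.Three.UnramifiedAdditiveDescent
import Summits.BirchSwinnertonDyer.Rank1Residual.X11b.Three.UnramifiedMinimalWitness
import HarnessLib

/-!
# X11b at `p = 3` (team N8/O2), JET3-KUMMER: the `K_v`-minimal equation stays minimal over the
# S15 layer in EVERY residue characteristic — Silverman *AEC* VII.5.4 (a) by Galois descent of
# the non-minimality witness (S15 (ix), part 19; no Tate's algorithm)

HONEST FRAMING (cell `b2b-bsdres`, run/shared/lean/b2b/bsd-rank1-residual/, verbatim in every
file): the goal of the cell is to DELETE the COMBINATION-SHAPED residual classes of the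
Birch–Swinnerton-Dyer formula for ALL analytic-rank `≤ 1` elliptic curves over `ℚ` — "full BSD
formula for every rank `≤ 1` curve in class `C`" assembled STRICTLY from published theorems — so
that the rank-`≤ 1` remainder becomes exactly the CONSTRUCTION-SHAPED classes, which are TYPED
(missing-input `Prop`s), NOT attempted. This is not "finishing BSD". Team N8/O2 = `x11b3`, seat
`b2b-bsdres-x11b3-p4` (provider of record at additive places), S15 (ix) part 19 (lead R7-57).
THEOREMS ONLY: no definition, no named fact, no `sorry`; nothing is booked; `JET@p|N` is NOT
discharged.

## What

The residual binder R7′ of the S15 interface (`[(X ⊗ L).IsMinimal R]`: the `K_v`-minimal equation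
stays minimal over the valuation ring `R` of the unramified layer) was a theorem at multiplicative
places (part 3) and at additive places of residue characteristic `≥ 5` (part 16), and a LABELLED
residual at residue characteristic `2, 3`. This file proves it in EVERY residue characteristic from
the layer data R1–R6 alone, WITHOUT Tate's algorithm, by Galois descent of the non-minimality
witness of part 18 (`UnramifiedMinimalWitness`: the witnesses `(r, s, t) ∈ R³`,
`ϖⁱ ∣ aᵢ((1; r, s, t) • M)`, form ONE coset stable under automorphisms fixing `M` and `ϖ`).

* §1 **`isMinimal_baseChange_of_frobenius`** — *AEC* VII.5.4 (a), minimality half, over the S15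
  layer (binders R1 `hR`, R2 `[IsAdicComplete 𝔪 R]`, R3 `[Finite k]` + `hcard`, R4 `φ`/`hφ`/`hn`/
  `hfrob`, R5 `hϖ`/`hπ`, R6 `[IsGalois F L]`; `R₀ → R` local): `(X ⊗ F).IsMinimal R₀ →
  (X ⊗ L).IsMinimal R`. Proof: an integral `C • (X ⊗ L)` with `v(u) < 1` yields a witness over `R`
  (VII.1.3 (b)); the classes `s mod 𝔪`, `r mod 𝔪²`, `t mod 𝔪³` are invariant under the
  restriction `e` of `φ` (part 18) and descend to `R₀` one after the other by part 17
  (`exists_ringEquiv_frobenius_descent`: additive Hilbert 90 for the layer); the descended witness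
  lies in `𝔪₀ⁱ` by part 16 (`algebraMap_mem_maximalIdeal_pow_iff`, `e = 1`) and contradicts
  `R₀`-minimality (tree `not_isMinimal_of_pow_dvd`, *ATAEC* IV.9.4 Step 11).
  Corollaries: `hasAdditiveReduction_baseChange_of_frobenius`, and for `E/ℚ` at ANY prime `p`:
  `isMinimal_baseChange_padic_of_frobenius`, `hasAdditiveReduction_baseChange_padic_of_frobenius`.

EFFECT: R7′ is RETIRED — `[((W ⊗ ℚ_p) ⊗ L).IsMinimal R]` of parts 14/15 / `AdditivePlaceKummer` is
dischargeable by `haveI := isMinimal_baseChange_padic_of_frobenius W p L R hR φ hφ hn hcard hfrob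
hϖ hπ` at every bad prime from R1–R6 (part 16 stays the binder-light route at `p ≥ 5`); this also
covers the additive place above `3` of the O5/O6 classes (cells/o5o6 TARGETS (G4-6) (i)).

References (locators only; no new fact): [cite: SilvermanAEC2009, Prop. VII.5.4 (a) (PDF p. 175),
VII.1 Prop. 1.3 (b)] [cite: SilvermanATAEC1994, IV.9.4 Step 11] [cite: SerreLocalFields1979, X §1].

## Design

No definitions; `noncomputable section`; `open scoped Classical`; universe `u` for `F`, `L`;
`L : Type` in §2. Axioms: `propext`, `Classical.choice`, `Quot.sound`.
-/

noncomputable section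

open scoped Classical

namespace Summit.BirchSwinnertonDyer.Rank1Residual.X11b.Three.JetchevKummer

open WeierstrassCurve IsDiscreteValuationRing IsDedekindDomain.HeightOneSpectrum
  Literature.NumberTheory.DiophantineGeometry.TateAlgorithm

universe u

/-! ### §1 The descent: *AEC* VII.5.4 (a), minimality half, over the S15 layer -/

section Descent

variable {F : Type u} [Field F] (X : WeierstrassCurve F) (L : Type u) [Field L] [Algebra F L]
  (R₀ : Type*) [CommRing R₀] [IsDomain R₀] [IsDiscreteValuationRing R₀] [Algebra R₀ F]
  [IsFractionRing R₀ F]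
  (R : Type*) [CommRing R] [IsDomain R] [IsDiscreteValuationRing R] [Algebra R L]
  [IsFractionRing R L]
  [Algebra R₀ R] [Algebra R₀ L] [IsScalarTower R₀ R L] [IsScalarTower R₀ F L]
  [IsLocalHom (algebraMap R₀ R)]

/-- **Silverman, *AEC* Prop. VII.5.4 (a), minimality half, over the S15 layer — EVERY residue
characteristic.** Let `R₀ → R` be the local homomorphism of discrete valuation rings of the
Galois layer `F ⊆ L`, `R` complete with finite residue field of order `qⁿ`, all of `Aut(L/F)`
preserving `R` (R1), `Aut(L/F) = ⟨φ⟩` with `φⁿ = 1` and `φ` lifting `x ↦ x^q` (R4), and a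
uniformiser of `R` coming from `F` (R5, unramified). If `X ⊗ F` is `R₀`-minimal then `X ⊗ L` is
`R`-minimal. Proof (no Tate's algorithm): a non-minimality witness over `R` is `(r, s, t) ∈ R³`
with `ϖⁱ ∣ aᵢ((1; r, s, t) • M)` for the `R₀`-model `M` (AEC VII.1.3 (b)); the witnesses form one
coset (`dvd_sub_of_witness`, `witness_move`) stable under the restriction `e` of `φ`
(`witness_map`), so the classes `s mod 𝔪`, `r mod 𝔪²`, `t mod 𝔪³` are `e`-invariant and descend
to `R₀` in turn (part 17 `exists_ringEquiv_frobenius_descent`: additive Hilbert 90 for the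
layer); the descended witness contradicts `R₀`-minimality (part 16
`algebraMap_mem_maximalIdeal_pow_iff`, tree `not_isMinimal_of_pow_dvd`). This DISCHARGES the
residual binder R7′ `[(X ⊗ L).IsMinimal R]` of S15 from R1–R6 alone.
[cite: SilvermanAEC2009, Prop. VII.5.4 (a) (PDF p. 175), VII.1 Prop. 1.3 (b) (PDF p. 165)]
[cite: SerreLocalFields1979, X §1 Prop. 1] -/
theorem isMinimal_baseChange_of_frobenius [IsGalois F L]
    [IsAdicComplete (IsLocalRing.maximalIdeal R) R] [Finite (IsLocalRing.ResidueField R)]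
    [(X.baseChange F).IsMinimal R₀]
    (hR : ∀ (τ : L ≃ₐ[F] L) (x : L), x ∈ Set.range (algebraMap R L) →
      τ x ∈ Set.range (algebraMap R L))
    (φ : L ≃ₐ[F] L) (hφ : ∀ σ : L ≃ₐ[F] L, σ ∈ Subgroup.zpowers φ) {q n : ℕ} (hn : φ ^ n = 1)
    (hcard : Nat.card (IsLocalRing.ResidueField R) = q ^ n)
    (hfrob : ∀ a : R, ∃ a' : R, algebraMap R L a' = φ (algebraMap R L a) ∧
      IsLocalRing.residue R a' = IsLocalRing.residue R a ^ q)
    {ϖ : R} (hϖ : Irreducible ϖ) {π : F} (hπ : algebraMap F L π = algebraMap R L ϖ) :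
    (X.baseChange L).IsMinimal R := by
  haveI hint : (X.baseChange L).IsIntegral R := isIntegral_baseChange_of_isIntegral X L R₀ R
  by_cases hΔ : (X.baseChange F).Δ = 0
  · -- singular equation: every integral model is minimal
    have hΔL : (X.baseChange L).Δ = 0 := by
      have h0 : X.Δ = 0 := by
        rw [WeierstrassCurve.baseChange, map_Δ, Algebra.algebraMap_self, RingHom.id_apply] at hΔ
        exact hΔ
      rw [WeierstrassCurve.baseChange, map_Δ, h0, map_zero]
    refine ⟨⟨by simpa using hint, fun C hC _ ↦ ?_⟩⟩
    haveI : (C • X.baseChange L).IsIntegral R := hC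
    rw [← Subtype.coe_le_coe, valuation_Δ_aux_eq_of_isIntegral, variableChange_Δ, hΔL, mul_zero,
      map_zero]
    exact zero_le
  -- the `R₀`-model `M₀`, its image `M` over `R`, and the restriction `e` of `φ` to `R`
  have hinj : Function.Injective (algebraMap R L) := IsFractionRing.injective R L
  set M₀ : WeierstrassCurve R₀ := (X.baseChange F).integralModel R₀ with hM₀
  set M : WeierstrassCurve R := M₀.map (algebraMap R₀ R) with hM
  have hMV : M.map (algebraMap R L) = X.baseChange L := map_integralModel_baseChange_eq X L R₀ R
  have hΔ₀ : M₀.Δ ≠ 0 := fun h0 ↦ hΔ (by rw [← integralModel_Δ_eq R₀ (X.baseChange F), ← hM₀, h0,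
    map_zero])
  obtain ⟨π₀, -, hπ₀, -⟩ := exists_irreducible_algebraMap_eq L R₀ R hϖ hπ
  obtain ⟨e, -, he₀, hdesc⟩ := exists_ringEquiv_frobenius_descent L R₀ R hR φ hφ hn hcard hfrob hϖ hπ
  have hϖe : e ϖ = ϖ := by rw [← hπ₀, he₀]
  have hMe : M.map (e : R →+* R) = M := by
    rw [hM, WeierstrassCurve.map_map]
    congr 1
    ext a
    exact he₀ a
  -- the minimality criterion: an integral `C • (X ⊗ L)` with `v(u) < 1` is impossible
  rw [isMinimal_iff_of_le_one_iff (valuation_maximalIdeal_le_one_iff R (K := L)) (X.baseChange L)]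
  refine ⟨hint, fun C hC ↦ ?_⟩
  haveI := hC
  by_contra hlt
  rw [not_le] at hlt
  have hu : valuation L (maximalIdeal R) (C.u : L) < 1 := by
    by_contra hu
    rw [not_lt] at hu
    refine absurd ?_ (not_le.mpr hlt)
    rw [variableChange_Δ, map_mul, map_pow, map_units_inv]
    calc (valuation L (maximalIdeal R) (C.u : L))⁻¹ ^ 12 * valuation L (maximalIdeal R)
          (X.baseChange L).Δ
        ≤ 1 * valuation L (maximalIdeal R) (X.baseChange L).Δ :=
          mul_le_mul_left (pow_le_one' (inv_le_one_of_one_le₀ hu) _) _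
      _ = valuation L (maximalIdeal R) (X.baseChange L).Δ := one_mul _
  obtain ⟨μ, hμ⟩ := exists_lift_of_le_one hu.le
  have hμm : ϖ ∣ μ := by
    rw [← Ideal.mem_span_singleton, ← hϖ.maximalIdeal_eq,
      ← valuation_maximalIdeal_algebraMap_lt_one_iff R (K := L), hμ]
    exact hu
  -- the translation part of `C` is a witness over `R`
  set τℓ : VariableChange L := ⟨1, C.r, C.s, C.t⟩ with hτℓ
  have hCfac : C = ⟨C.u, 0, 0, 0⟩ * τℓ := by
    rw [hτℓ, VariableChange.mul_def]
    ext <;> simp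
  obtain ⟨m₁, hm₁⟩ : ∃ m : R, algebraMap R L m = (C • X.baseChange L).a₁ :=
    ⟨_, integralModel_a₁_eq R _⟩
  obtain ⟨m₂, hm₂⟩ : ∃ m : R, algebraMap R L m = (C • X.baseChange L).a₂ :=
    ⟨_, integralModel_a₂_eq R _⟩
  obtain ⟨m₃, hm₃⟩ : ∃ m : R, algebraMap R L m = (C • X.baseChange L).a₃ :=
    ⟨_, integralModel_a₃_eq R _⟩
  obtain ⟨m₄, hm₄⟩ : ∃ m : R, algebraMap R L m = (C • X.baseChange L).a₄ :=
    ⟨_, integralModel_a₄_eq R _⟩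
  obtain ⟨m₆, hm₆⟩ : ∃ m : R, algebraMap R L m = (C • X.baseChange L).a₆ :=
    ⟨_, integralModel_a₆_eq R _⟩
  have hCV : C • X.baseChange L = (⟨C.u, 0, 0, 0⟩ : VariableChange L) • (τℓ • X.baseChange L) := by
    rw [← mul_smul, ← hCfac]
  have hN₁ : (τℓ • X.baseChange L).a₁ = algebraMap R L (μ * m₁) := by
    have h := variableChange_a₁ (τℓ • X.baseChange L) (⟨C.u, 0, 0, 0⟩ : VariableChange L)
    rw [← hCV] at h
    rw [map_mul, hμ, hm₁, h]
    simp
  have hN₂ : (τℓ • X.baseChange L).a₂ = algebraMap R L (μ ^ 2 * m₂) := by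
    have h := variableChange_a₂ (τℓ • X.baseChange L) (⟨C.u, 0, 0, 0⟩ : VariableChange L)
    rw [← hCV] at h
    rw [map_mul, map_pow, hμ, hm₂, h]
    simp
  have hN₃ : (τℓ • X.baseChange L).a₃ = algebraMap R L (μ ^ 3 * m₃) := by
    have h := variableChange_a₃ (τℓ • X.baseChange L) (⟨C.u, 0, 0, 0⟩ : VariableChange L)
    rw [← hCV] at h
    rw [map_mul, map_pow, hμ, hm₃, h]
    simp
  have hN₄ : (τℓ • X.baseChange L).a₄ = algebraMap R L (μ ^ 4 * m₄) := by
    have h := variableChange_a₄ (τℓ • X.baseChange L) (⟨C.u, 0, 0, 0⟩ : VariableChange L)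
    rw [← hCV] at h
    rw [map_mul, map_pow, hμ, hm₄, h]
    simp
  have hN₆ : (τℓ • X.baseChange L).a₆ = algebraMap R L (μ ^ 6 * m₆) := by
    have h := variableChange_a₆ (τℓ • X.baseChange L) (⟨C.u, 0, 0, 0⟩ : VariableChange L)
    rw [← hCV] at h
    rw [map_mul, map_pow, hμ, hm₆, h]
    simp
  haveI hNint : (τℓ • X.baseChange L).IsIntegral R :=
    isIntegral_of_exists_lift R ⟨_, hN₁.symm⟩ ⟨_, hN₂.symm⟩ ⟨_, hN₃.symm⟩ ⟨_, hN₄.symm⟩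
      ⟨_, hN₆.symm⟩
  -- AEC VII.1.3 (b): `r, s, t ∈ R`
  have hτu : valuation L (maximalIdeal R) (τℓ.u : L) = 1 := by simp [hτℓ]
  have hvr : valuation L (maximalIdeal R) τℓ.r ≤ 1 :=
    valuation_r_le_one_of_isIntegral R (W₁ := X.baseChange L) (D := τℓ) rfl hτu
  have hvs : valuation L (maximalIdeal R) τℓ.s ≤ 1 :=
    valuation_s_le_one_of_isIntegral R (W₁ := X.baseChange L) (D := τℓ) rfl hτu hvr
  have hvt : valuation L (maximalIdeal R) τℓ.t ≤ 1 :=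
    valuation_t_le_one_of_isIntegral R (W₁ := X.baseChange L) (D := τℓ) rfl hτu hvr
  obtain ⟨r, hr⟩ := exists_lift_of_le_one hvr
  obtain ⟨s, hs⟩ := exists_lift_of_le_one hvs
  obtain ⟨t, ht⟩ := exists_lift_of_le_one hvt
  have hτR : (⟨1, r, s, t⟩ : VariableChange R).map (algebraMap R L) = τℓ := by
    rw [hτℓ]
    ext <;> simp [VariableChange.map, hr, hs, ht, hτℓ]
  have hNR : ((⟨1, r, s, t⟩ : VariableChange R) • M).map (algebraMap R L) = τℓ • X.baseChange L := by
    rw [← map_variableChange, hτR, hMV]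
  have hcoef : ∀ {a b : R}, algebraMap R L a = algebraMap R L b → a = b := fun h ↦ hinj h
  have h1 : ϖ ∣ ((⟨1, r, s, t⟩ : VariableChange R) • M).a₁ := by
    have h := congrArg WeierstrassCurve.a₁ hNR
    rw [map_a₁, hN₁] at h
    rw [hcoef h]
    exact hμm.mul_right _
  have h2 : ϖ ^ 2 ∣ ((⟨1, r, s, t⟩ : VariableChange R) • M).a₂ := by
    have h := congrArg WeierstrassCurve.a₂ hNR
    rw [map_a₂, hN₂] at h
    rw [hcoef h]
    exact (pow_dvd_pow_of_dvd hμm 2).mul_right _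
  have h3 : ϖ ^ 3 ∣ ((⟨1, r, s, t⟩ : VariableChange R) • M).a₃ := by
    have h := congrArg WeierstrassCurve.a₃ hNR
    rw [map_a₃, hN₃] at h
    rw [hcoef h]
    exact (pow_dvd_pow_of_dvd hμm 3).mul_right _
  have h4 : ϖ ^ 4 ∣ ((⟨1, r, s, t⟩ : VariableChange R) • M).a₄ := by
    have h := congrArg WeierstrassCurve.a₄ hNR
    rw [map_a₄, hN₄] at h
    rw [hcoef h]
    exact (pow_dvd_pow_of_dvd hμm 4).mul_right _
  have h6 : ϖ ^ 6 ∣ ((⟨1, r, s, t⟩ : VariableChange R) • M).a₆ := by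
    have h := congrArg WeierstrassCurve.a₆ hNR
    rw [map_a₆, hN₆] at h
    rw [hcoef h]
    exact (pow_dvd_pow_of_dvd hμm 6).mul_right _
  -- DESCENT (a): the class `s mod 𝔪` is `e`-invariant, hence comes from `R₀`
  obtain ⟨g1, g2, g3, g4, g6⟩ := witness_map R M e hMe hϖe h1 h2 h3 h4 h6
  obtain ⟨-, hds, -⟩ := dvd_sub_of_witness R M hϖ h1 h2 h3 h4 h6 g1 g2 g3 g4 g6
  obtain ⟨s₀, hs₀⟩ := hdesc 1 s
    (by rw [pow_one, hϖ.maximalIdeal_eq, Ideal.mem_span_singleton]; exact hds)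
  rw [pow_one, hϖ.maximalIdeal_eq, Ideal.mem_span_singleton] at hs₀
  obtain ⟨σ, hσ⟩ := hs₀
  obtain ⟨k1, k2, k3, k4, k6⟩ := witness_move R M ϖ 0 (-σ) 0 h1 h2 h3 h4 h6
  have ek : (⟨1, r + ϖ ^ 2 * 0, s + ϖ * -σ, t + s * ϖ ^ 2 * 0 + ϖ ^ 3 * 0⟩ : VariableChange R) =
      ⟨1, r, algebraMap R₀ R s₀, t⟩ := by
    ext <;> simp
    linear_combination hσ
  rw [ek] at k1 k2 k3 k4 k6
  -- DESCENT (b): the class `r mod 𝔪²`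
  obtain ⟨g1, g2, g3, g4, g6⟩ := witness_map R M e hMe hϖe k1 k2 k3 k4 k6
  rw [he₀] at g1 g2 g3 g4 g6
  obtain ⟨hdr, -, -⟩ := dvd_sub_of_witness R M hϖ k1 k2 k3 k4 k6 g1 g2 g3 g4 g6
  obtain ⟨r₀, hr₀⟩ := hdesc 2 r
    (by rw [hϖ.maximalIdeal_eq, Ideal.span_singleton_pow, Ideal.mem_span_singleton]; exact hdr)
  rw [hϖ.maximalIdeal_eq, Ideal.span_singleton_pow, Ideal.mem_span_singleton] at hr₀
  obtain ⟨ρ, hρ⟩ := hr₀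
  obtain ⟨l1, l2, l3, l4, l6⟩ := witness_move R M ϖ (-ρ) 0 0 k1 k2 k3 k4 k6
  have el : (⟨1, r + ϖ ^ 2 * -ρ, algebraMap R₀ R s₀ + ϖ * 0,
      t + algebraMap R₀ R s₀ * ϖ ^ 2 * -ρ + ϖ ^ 3 * 0⟩ : VariableChange R) =
      ⟨1, algebraMap R₀ R r₀, algebraMap R₀ R s₀, t - algebraMap R₀ R s₀ * ϖ ^ 2 * ρ⟩ := by
    ext <;> simp
    · linear_combination hρ
    · ring
  rw [el] at l1 l2 l3 l4 l6
  -- DESCENT (c): the class `t mod 𝔪³`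
  obtain ⟨g1, g2, g3, g4, g6⟩ := witness_map R M e hMe hϖe l1 l2 l3 l4 l6
  rw [he₀, he₀] at g1 g2 g3 g4 g6
  obtain ⟨-, -, hdt⟩ := dvd_sub_of_witness R M hϖ l1 l2 l3 l4 l6 g1 g2 g3 g4 g6
  rw [sub_self, mul_zero, sub_zero] at hdt
  obtain ⟨t₀, ht₀⟩ := hdesc 3 _
    (by rw [hϖ.maximalIdeal_eq, Ideal.span_singleton_pow, Ideal.mem_span_singleton]; exact hdt)
  rw [hϖ.maximalIdeal_eq, Ideal.span_singleton_pow, Ideal.mem_span_singleton] at ht₀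
  obtain ⟨θ, hθ⟩ := ht₀
  obtain ⟨n1, n2, n3, n4, n6⟩ := witness_move R M ϖ 0 0 (-θ) l1 l2 l3 l4 l6
  have en : (⟨1, algebraMap R₀ R r₀ + ϖ ^ 2 * 0, algebraMap R₀ R s₀ + ϖ * 0,
      t - algebraMap R₀ R s₀ * ϖ ^ 2 * ρ + algebraMap R₀ R s₀ * ϖ ^ 2 * 0 + ϖ ^ 3 * -θ⟩ :
        VariableChange R) =
      ⟨1, algebraMap R₀ R r₀, algebraMap R₀ R s₀, algebraMap R₀ R t₀⟩ := by
    ext <;> simp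
    linear_combination hθ
  rw [en] at n1 n2 n3 n4 n6
  -- the witness over `R₀` contradicts `R₀`-minimality
  set τ₀ : VariableChange R₀ := ⟨1, r₀, s₀, t₀⟩ with hτ₀
  have hN₀ : (τ₀ • M₀).map (algebraMap R₀ R) =
      (⟨1, algebraMap R₀ R r₀, algebraMap R₀ R s₀, algebraMap R₀ R t₀⟩ : VariableChange R) • M := by
    rw [← map_variableChange, ← hM]
    congr 1
    rw [hτ₀]
    ext <;> simp [VariableChange.map]
  have hdesc₀ : ∀ (i : ℕ) (a : R₀), ϖ ^ i ∣ algebraMap R₀ R a → uniformizer R₀ ^ i ∣ a := by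
    intro i a ha
    rw [← mem_maximalIdeal_pow_iff_dvd, ← algebraMap_mem_maximalIdeal_pow_iff L R₀ R hϖ hπ,
      hϖ.maximalIdeal_eq, Ideal.span_singleton_pow, Ideal.mem_span_singleton]
    exact ha
  have d1 : uniformizer R₀ ∣ (τ₀ • M₀).a₁ := by
    have h := congrArg WeierstrassCurve.a₁ hN₀
    rw [map_a₁] at h
    have := hdesc₀ 1 _ (by rw [pow_one, h]; exact n1)
    rwa [pow_one] at this
  have d2 : uniformizer R₀ ^ 2 ∣ (τ₀ • M₀).a₂ := by
    have h := congrArg WeierstrassCurve.a₂ hN₀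
    rw [map_a₂] at h
    exact hdesc₀ 2 _ (by rw [h]; exact n2)
  have d3 : uniformizer R₀ ^ 3 ∣ (τ₀ • M₀).a₃ := by
    have h := congrArg WeierstrassCurve.a₃ hN₀
    rw [map_a₃] at h
    exact hdesc₀ 3 _ (by rw [h]; exact n3)
  have d4 : uniformizer R₀ ^ 4 ∣ (τ₀ • M₀).a₄ := by
    have h := congrArg WeierstrassCurve.a₄ hN₀
    rw [map_a₄] at h
    exact hdesc₀ 4 _ (by rw [h]; exact n4)
  have d6 : uniformizer R₀ ^ 6 ∣ (τ₀ • M₀).a₆ := by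
    have h := congrArg WeierstrassCurve.a₆ hN₀
    rw [map_a₆] at h
    exact hdesc₀ 6 _ (by rw [h]; exact n6)
  have key := not_isMinimal_of_pow_dvd F hΔ₀ τ₀ d1 d2 d3 d4 d6
  rw [hM₀, baseChange_integralModel_eq R₀ (X.baseChange F)] at key
  exact key ‹_›

/-- **Silverman, *AEC* Prop. VII.5.4 (a), additive case, over the S15 layer — every residue
characteristic.** `(X ⊗ F).HasAdditiveReduction R₀ → (X ⊗ L).HasAdditiveReduction R` under the
layer data R1–R6 (minimality by `isMinimal_baseChange_of_frobenius`; `v(Δ) > 0`, `v(c₄) > 0` by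
part 14 `hasAdditiveReduction_baseChange_of_isMinimal`).
[cite: SilvermanAEC2009, Prop. VII.5.4 (a) (PDF p. 175)] -/
theorem hasAdditiveReduction_baseChange_of_frobenius [IsGalois F L]
    [IsAdicComplete (IsLocalRing.maximalIdeal R) R] [Finite (IsLocalRing.ResidueField R)]
    [(X.baseChange F).HasAdditiveReduction R₀]
    (hR : ∀ (τ : L ≃ₐ[F] L) (x : L), x ∈ Set.range (algebraMap R L) →
      τ x ∈ Set.range (algebraMap R L))
    (φ : L ≃ₐ[F] L) (hφ : ∀ σ : L ≃ₐ[F] L, σ ∈ Subgroup.zpowers φ) {q n : ℕ} (hn : φ ^ n = 1)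
    (hcard : Nat.card (IsLocalRing.ResidueField R) = q ^ n)
    (hfrob : ∀ a : R, ∃ a' : R, algebraMap R L a' = φ (algebraMap R L a) ∧
      IsLocalRing.residue R a' = IsLocalRing.residue R a ^ q)
    {ϖ : R} (hϖ : Irreducible ϖ) {π : F} (hπ : algebraMap F L π = algebraMap R L ϖ) :
    (X.baseChange L).HasAdditiveReduction R := by
  haveI := isMinimal_baseChange_of_frobenius X L R₀ R hR φ hφ hn hcard hfrob hϖ hπ
  exact hasAdditiveReduction_baseChange_of_isMinimal X L R₀ R

end Descent

/-! ### §2 `E/ℚ` at ANY prime: R7′ retired -/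

section Padic

variable (W : WeierstrassCurve ℚ) [W.IsElliptic] [W.IsGloballyMinimal] (p : ℕ) [Fact p.Prime]
  (L : Type) [Field L] [Algebra ℚ_[p] L]
  (R : Type*) [CommRing R] [IsDomain R] [IsDiscreteValuationRing R] [Algebra R L]
  [IsFractionRing R L] [Algebra ℤ_[p] R] [Algebra ℤ_[p] L] [IsScalarTower ℤ_[p] R L]
  [IsScalarTower ℤ_[p] ℚ_[p] L] [IsLocalHom (algebraMap ℤ_[p] R)]

omit [W.IsElliptic] in
/-- **R7′ RETIRED for `E/ℚ` at every prime `p` (including `2` and `3`).** For `W/ℚ` globally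
minimal and a complete Galois layer `L ⊇ ℚ_p` with valuation ring `R` (`ℤ_p → R` local, finite
residue field of `qⁿ` elements, `Aut(L/ℚ_p) = ⟨φ⟩`, `φⁿ = 1`, `φ` lifting `x ↦ x^q`, every `τ`
preserving `R`, a uniformiser of `R` from `ℚ_p`): `(W ⊗ ℚ_p) ⊗ L` is `R`-minimal. Use
`haveI := isMinimal_baseChange_padic_of_frobenius W p L R hR φ hφ hn hcard hfrob hϖ hπ` before any
statement of parts 14/15 or `AdditivePlaceKummer` carrying `[((W ⊗ ℚ_p) ⊗ L).IsMinimal R]`.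
[cite: SilvermanAEC2009, Prop. VII.5.4 (a) (PDF p. 175), VIII.8] -/
theorem isMinimal_baseChange_padic_of_frobenius [IsGalois ℚ_[p] L]
    [IsAdicComplete (IsLocalRing.maximalIdeal R) R] [Finite (IsLocalRing.ResidueField R)]
    (hR : ∀ (τ : L ≃ₐ[ℚ_[p]] L) (x : L), x ∈ Set.range (algebraMap R L) →
      τ x ∈ Set.range (algebraMap R L))
    (φ : L ≃ₐ[ℚ_[p]] L) (hφ : ∀ σ : L ≃ₐ[ℚ_[p]] L, σ ∈ Subgroup.zpowers φ) {q n : ℕ}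
    (hn : φ ^ n = 1) (hcard : Nat.card (IsLocalRing.ResidueField R) = q ^ n)
    (hfrob : ∀ a : R, ∃ a' : R, algebraMap R L a' = φ (algebraMap R L a) ∧
      IsLocalRing.residue R a' = IsLocalRing.residue R a ^ q)
    {ϖ : R} (hϖ : Irreducible ϖ) {π : ℚ_[p]} (hπ : algebraMap ℚ_[p] L π = algebraMap R L ϖ) :
    ((W.baseChange ℚ_[p]).baseChange L).IsMinimal R := by
  haveI := isMinimal_baseChange_padic_self W p
  exact isMinimal_baseChange_of_frobenius (W.baseChange ℚ_[p]) L ℤ_[p] R hR φ hφ hn hcard hfrob hϖ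
    hπ

/-- **Additive reduction at ANY bad prime `p` of additive type, over every S15 layer, NO
residual**: part 15's `hasAdditiveReduction_baseChange_padic_of_isMinimal` with R7′ discharged by
`isMinimal_baseChange_padic_of_frobenius`. [cite: SilvermanAEC2009, Prop. VII.5.4 (a) (PDF p. 175)] -/
theorem hasAdditiveReduction_baseChange_padic_of_frobenius [IsGalois ℚ_[p] L]
    [IsAdicComplete (IsLocalRing.maximalIdeal R) R] [Finite (IsLocalRing.ResidueField R)]
    (hg : ¬ W.HasGoodReductionAtPrime p) (hm : ¬ W.HasMultiplicativeReductionAtPrime p)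
    (hR : ∀ (τ : L ≃ₐ[ℚ_[p]] L) (x : L), x ∈ Set.range (algebraMap R L) →
      τ x ∈ Set.range (algebraMap R L))
    (φ : L ≃ₐ[ℚ_[p]] L) (hφ : ∀ σ : L ≃ₐ[ℚ_[p]] L, σ ∈ Subgroup.zpowers φ) {q n : ℕ}
    (hn : φ ^ n = 1) (hcard : Nat.card (IsLocalRing.ResidueField R) = q ^ n)
    (hfrob : ∀ a : R, ∃ a' : R, algebraMap R L a' = φ (algebraMap R L a) ∧
      IsLocalRing.residue R a' = IsLocalRing.residue R a ^ q)
    {ϖ : R} (hϖ : Irreducible ϖ) {π : ℚ_[p]} (hπ : algebraMap ℚ_[p] L π = algebraMap R L ϖ) :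
    ((W.baseChange ℚ_[p]).baseChange L).HasAdditiveReduction R := by
  haveI := isMinimal_baseChange_padic_of_frobenius W p L R hR φ hφ hn hcard hfrob hϖ hπ
  exact hasAdditiveReduction_baseChange_padic_of_isMinimal W p L R hg hm

end Padic

end Summit.BirchSwinnertonDyer.Rank1Residual.X11b.Three.JetchevKummer

end
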